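import Literature.Barriers.CriticalPhenomena.PlaquetteWalkHoleRootCorridor
import HarnessLib

/-!
# Barrier catalogue (SAWScalingLimit): THE HOLE COLUMN — with the column below the hole shut, a wound under-walk's
EXCURSION takes the door between the cells below the hole and below the root plaquette; its prefix never does

Leaf of `PlaquetteWalkHoleRootCorridor` (the even–odd rule for the south-eastern quadrant). The root plaquette `w`, the
hole `(w.1 − 1, w.2)` absent, the far cell `f = (w.1 − 2, w.2)`; this file's region is the LOWER EAST
`{c : w.1 ≤ c.1, c.2 ≤ w.2 − 1}` — the south-eastern quadrant widened by the root plaquette's own column (§1: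
`InLowerEast`, its top edges `IsTopEdgeLE` = ALL unit edges of the eastern ray of the hole, the root plaquette's bottom
side included (`isTopEdgeLE_iff`), its west edges `IsWestEdgeLE` = the western sides of the root column below the root
row; `lowerEast_change_iff`). §2 ★★★ `ΩG.odd_card_westEdgeLE_of_AJ_ne_zero`: a class-`B2a` walk at the far cell whose
excursion polygon winds around the root crosses the west edges of the lower east an odd number of times (its top-edge
crossings ARE the ray count, odd by the winding parity law; the excursion starts and ends west of the region). §3 ★★★★
`ΩG.exists_nth_eq_rootS_W_of_AJ_ne_zero_holeColumn`: if the column below the hole is shut — `(w.1 − 1, y) ∉ D` for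
every `y ≤ w.2 − 2` — the only crossable west edge is the door between `holeS = (w.1 − 1, w.2 − 1)` and
`rootS = (w.1, w.2 − 1)`, so the EXCURSION crosses the `W` side of `rootS`; §4 the wound form (either orientation of
the winding witness: the reversed companion has the same prefix and the same set of excursion mid-edges) ★★★★
`ΩG.exists_excursion_nth_eq_rootS_W_of_wound_holeColumn`, and ★★★★ `ΩG.prefix_nth_ne_rootS_W_of_wound_holeColumn`:
the PREFIX of a wound walk never takes that door (a mid-edge is visited once). In particular (§4,
`ΩG.not_wound_of_prefix_rootS_holeS_holeColumn`) an under-walk whose prefix reaches the far cell along the row below the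
hole — `… → rootS → holeS → farSW → f` — is never wound: with the column below the hole shut, every wound under-walk's
prefix runs OVER the hole. This is the typed half of the lane's datum «removing the cell two rows below the hole
EMPTIES the under route» (kit j283492: no free wound under-walk ≤ 44 arcs in `7×5 ∖ {hole, (3,0)}`); the other half —
an over-the-top prefix walls the far cell in (a Jordan argument on the prefix loop, cf. `PlaquetteWalkHoleRootPrefixLoop`)
— is not typed here.

Not in print; venture lane «pcv-sawmu», seat b-step0 gen 26.

References: A. Glazman, I. Manolescu, arXiv:1708.00395v3, §1 (Fig. 1, Fig. 2), §2.1 and Lemma 2.1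
[GlazmanManolescu2019]; A. Glazman, Electron. Commun. Probab. 20 (2015) no. 86, Lemma 3.1, proof pp. 6–7
[Glazman2015WeightedSAW]; R. Courant, H. Robbins, *What is Mathematics?* (1941/1958), Ch. V Appendix §2 (the even–odd
rule) [CourantRobbins1958].
-/

noncomputable section

open Set Function Complex

namespace Literature.Probability.RandomPlanarGeometry.SAW.YangBaxter

open Real

open private fc_ne rev_snd_nth rev_snd_length rev_firstHit from Literature.Probability.RandomPlanarGeometry.YangBaxterSAWGeneralDomain
open private side_jOut from Literature.Probability.RandomPlanarGeometry.YangBaxterSAWExcursionJordan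

/-! ## §1 The lower east: the south-eastern quadrant widened by the root column -/

section LowerEast

variable (w : Face)

/-- The lower east: the cells of the root plaquette's column or east of it, below the root row.
[cite: CourantRobbins1958, Ch. V Appendix §2 (The Jordan Curve Theorem for Polygons: the even–odd rule)] -/
def InLowerEast (c : Face) : Prop := w.1 ≤ c.1 ∧ c.2 ≤ w.2 - 1

/-- The top edges of the lower east: the bottom line of the root row from the root plaquette eastwards — all unit edges
of the eastern ray of the hole. [cite: CourantRobbins1958, Ch. V Appendix §2 (the even–odd rule)] -/
def IsTopEdgeLE : MidEdge → Prop
  | .slant x y => w.1 ≤ x ∧ y = w.2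
  | .vert _ _ => False

/-- The west edges of the lower east: the west sides of the root plaquette's column below the root row.
[cite: CourantRobbins1958, Ch. V Appendix §2 (the even–odd rule)] -/
def IsWestEdgeLE : MidEdge → Prop
  | .vert x y => x = w.1 ∧ y ≤ w.2 - 1
  | .slant _ _ => False

/-- **Crossing the boundary of the lower east**: two distinct faces sharing the mid-edge `e` lie on different sides of
it iff `e` is a top or a west edge. [cite: CourantRobbins1958, Ch. V Appendix §2 (the even–odd rule)] -/
theorem lowerEast_change_iff {e : MidEdge} {F₁ F₂ : Face} (h₁ : ∃ s, F₁.side s = e) (h₂ : ∃ s, F₂.side s = e)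
    (hne : F₁ ≠ F₂) : ¬(InLowerEast w F₁ ↔ InLowerEast w F₂) ↔ (IsTopEdgeLE w e ∨ IsWestEdgeLE w e) := by
  rcases (Face.exists_side_eq_iff F₁ e).1 h₁ with e₁ | e₁ <;> rcases (Face.exists_side_eq_iff F₂ e).1 h₂ with e₂ | e₂
  · exact absurd (e₁.trans e₂.symm) hne
  · subst e₁; subst e₂
    cases e <;> simp only [MidEdge.faces, InLowerEast, IsTopEdgeLE, IsWestEdgeLE, or_false, false_or] <;> omega
  · subst e₁; subst e₂
    cases e <;> simp only [MidEdge.faces, InLowerEast, IsTopEdgeLE, IsWestEdgeLE, or_false, false_or] <;> omega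
  · exact absurd (e₁.trans e₂.symm) hne

/-- A top edge is not a west edge. [cite: CourantRobbins1958, Ch. V Appendix §2 (the even–odd rule)] -/
theorem not_isTopEdgeLE_and_isWestEdgeLE (e : MidEdge) : ¬(IsTopEdgeLE w e ∧ IsWestEdgeLE w e) := by
  cases e <;> simp [IsTopEdgeLE, IsWestEdgeLE]

/-- The top edges are exactly the edges of the eastern ray of the hole (the root plaquette's bottom side is the edge
`m = 0`). [cite: CourantRobbins1958, Ch. V Appendix §2 (the even–odd rule)] -/
theorem isTopEdgeLE_iff (e : MidEdge) : IsTopEdgeLE w e ↔ ∃ m : ℕ, e = rayMid (holeFaceW w) .E m := by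
  constructor
  · intro h
    cases e with
    | vert x y => exact absurd h (by simp [IsTopEdgeLE])
    | slant x y =>
      simp only [IsTopEdgeLE] at h
      refine ⟨(x - w.1).toNat, ?_⟩
      rw [rayMid_holeFaceW_E_eq]
      congr 1 <;> omega
  · rintro ⟨m, rfl⟩
    rw [rayMid_holeFaceW_E_eq]
    simp only [IsTopEdgeLE, and_true]
    omega

/-- A face next to the far cell other than the far cell is outside the lower east.
[cite: GlazmanManolescu2019, §1 (the lattice of rhombi and its mid-edges)] -/
theorem not_inLowerEast_of_side_farW {F : Face} {s t : Side} (h : F.side s = (farW w).side t) (hne : F ≠ farW w) :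
    ¬InLowerEast w F := by
  rcases (Face.exists_side_eq_iff F ((farW w).side t)).1 ⟨s, h⟩ with e | e <;>
    obtain ⟨k, j⟩ := w <;> cases t <;>
      simp only [farW, Face.side, MidEdge.faces, InLowerEast] at e hne ⊢ <;>
      (subst e; first | (exact absurd rfl hne) | (simp only [not_and, not_le]; omega))

/-- The `W` side of the cell below the root plaquette, in coordinates. [cite: GlazmanManolescu2019, §1 (mid-edges)] -/
theorem rootS_side_W_eq : (rootS w).side .W = MidEdge.vert w.1 (w.2 - 1) := by
  obtain ⟨a, b⟩ := w; rfl

end LowerEast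

namespace ΩG

variable {D : Set Face} {w : Face}

/-! ## §2 The even–odd rule for the lower east -/

/-- ★★★ **THE WEST EDGES OF THE LOWER EAST ARE CROSSED AN ODD NUMBER OF TIMES** by the excursion of a class-`B2a` walk
at the far cell whose excursion polygon winds around the root: the top-edge crossings are exactly the eastern ray
count — odd by the winding parity law — and the excursion starts and ends west of the region, so its boundary
crossings are even. [cite: CourantRobbins1958, Ch. V Appendix §2 (the even–odd rule)]
[cite: Glazman2015WeightedSAW, Lemma 3.1 (proof, pp. 6–7)] -/
theorem odd_card_westEdgeLE_of_AJ_ne_zero [DecidablePred (IsWestEdgeLE w)] (ω : ΩG D (w.side .W) (farW w)) (hr : RootedFace D (w.side .W) (farW w))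
    (h : ω.IsB2a) (hA : ω.AJ hr h (toC (midPt (w.side .W))) ≠ 0) :
    Odd ((Finset.Ioc (ω.2.firstHitG + 1) (ω.2.arcs.length - 1)).filter
      fun k => IsWestEdgeLE w (ω.2.nth k)).card := by
  classical
  have hodd := (ω.AJ_root_ne_zero_iff_odd_rayCountAt (hr := hr) h (b := holeFaceW w) (τ := .E)
    (holeFaceW_side_E w)).1 hA
  have hF := ω.fh_lt h
  have hB2 : ω.2.firstHitG + 1 < ω.2.arcs.length := h.1
  set F := ω.2.firstHitG with hFdef
  set n := ω.2.arcs.length with hndef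
  let b : ℕ → Bool := fun k => decide (InLowerEast w (ω.2.fc k))
  have hbF : b (F + 1) = false := by
    have hin := (ω.2.side_sIn_nth (i := F + 1) hB2).1
    rw [(ω.2.exitSide_specG hr hF).1] at hin
    have hne : ω.2.fc (F + 1) ≠ farW w := fc_ne ω hr h (by omega) hB2
    simp only [b, decide_eq_false_iff_not]
    exact not_inLowerEast_of_side_farW w hin hne
  have hbL : b (n - 1) = false := by
    have hout := (ω.2.side_sIn_nth (i := n - 1) (by omega)).2.1
    rw [show n - 1 + 1 = n by omega, ω.2.nth_length] at hout
    have hne : ω.2.fc (n - 1) ≠ farW w := fc_ne ω hr h (by omega) (by omega)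
    simp only [b, decide_eq_false_iff_not]
    exact not_inLowerEast_of_side_farW w hout hne
  have heven := (even_card_changes_iff b (F + 1) (n - 1) (by omega)).2 (hbF.trans hbL.symm)
  have hchg : ∀ k ∈ Finset.Ioc (F + 1) (n - 1),
      (b (k - 1) ≠ b k ↔ IsTopEdgeLE w (ω.2.nth k) ∨ IsWestEdgeLE w (ω.2.nth k)) := by
    intro k hk
    rw [Finset.mem_Ioc] at hk
    have hout := (ω.2.side_sIn_nth (i := k - 1) (by omega)).2.1
    have hin := (ω.2.side_sIn_nth (i := k) (by omega)).1
    rw [show k - 1 + 1 = k by omega] at hout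
    have hne : ω.2.fc (k - 1) ≠ ω.2.fc (k - 1 + 1) := YBWalk.fc_succ_ne (by omega)
    rw [show k - 1 + 1 = k by omega] at hne
    have key := lowerEast_change_iff w ⟨_, hout⟩ ⟨_, hin⟩ hne
    simp only [b, ne_eq, decide_eq_decide]
    exact key
  set K := Finset.Ioc (F + 1) (n - 1) with hKdef
  set T := K.filter fun k => IsTopEdgeLE w (ω.2.nth k) with hTdef
  set E := K.filter fun k => IsWestEdgeLE w (ω.2.nth k) with hEdef
  have hsplit : (K.filter fun k => b (k - 1) ≠ b k) = T ∪ E := by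
    ext k
    simp only [hTdef, hEdef, Finset.mem_union, Finset.mem_filter]
    constructor
    · rintro ⟨hk, hb⟩
      rcases (hchg k hk).1 hb with ht | he
      · exact Or.inl ⟨hk, ht⟩
      · exact Or.inr ⟨hk, he⟩
    · rintro (⟨hk, ht⟩ | ⟨hk, he⟩)
      · exact ⟨hk, (hchg k hk).2 (Or.inl ht)⟩
      · exact ⟨hk, (hchg k hk).2 (Or.inr he)⟩
  have hdisj : Disjoint T E := by
    rw [Finset.disjoint_filter]
    intro k _ ht he
    exact not_isTopEdgeLE_and_isWestEdgeLE w _ ⟨ht, he⟩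
  rw [hsplit, Finset.card_union_of_disjoint hdisj] at heven
  have hT : T.card = ω.rayCountAt hr h (holeFaceW w) .E := by
    unfold ΩG.rayCountAt
    have hexit : ∀ j < ω.Mv, (ω.jFace h j).side (ω.jOut hr h j) = ω.2.nth (F + j + 1) :=
      fun j hj => side_jOut (hr := hr) h hj
    have hFM : F + ω.Mv = n := by unfold ΩG.Mv; omega
    symm
    refine Finset.card_bij' (fun j _ => F + j + 1) (fun k _ => k - F - 1) ?_ ?_ ?_ ?_
    · intro j hj
      rw [Finset.mem_filter, Finset.mem_range] at hj
      obtain ⟨hjM, m, hm⟩ := hj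
      rw [hexit j hjM] at hm
      have hlt : F + j + 1 ≤ n - 1 ∧ F + 2 ≤ F + j + 1 := by
        have h1 : F + j + 1 ≠ n := by
          intro e
          rw [e, ω.2.nth_length, rayMid_holeFaceW_E_eq] at hm
          exact farW_side_ne_slant_east w ω.1 m hm
        have h2 : j ≠ 0 := by
          rintro rfl
          rw [Nat.add_zero, (ω.2.exitSide_specG hr hF).1, rayMid_holeFaceW_E_eq] at hm
          exact farW_side_ne_slant_east w _ m hm
        omega
      rw [hTdef, Finset.mem_filter, hKdef, Finset.mem_Ioc]
      exact ⟨⟨by omega, hlt.1⟩, (isTopEdgeLE_iff w _).2 ⟨m, hm⟩⟩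
    · intro k hk
      rw [hTdef, Finset.mem_filter, hKdef, Finset.mem_Ioc] at hk
      obtain ⟨⟨hk1, hk2⟩, ht⟩ := hk
      obtain ⟨m, hm⟩ := (isTopEdgeLE_iff w _).1 ht
      rw [Finset.mem_filter, Finset.mem_range]
      refine ⟨by omega, m, ?_⟩
      rw [hexit _ (by omega), show F + (k - F - 1) + 1 = k by omega]
      exact hm
    · intro j hj; omega
    · intro k hk
      rw [hTdef, Finset.mem_filter, hKdef, Finset.mem_Ioc] at hk
      omega
  rw [hT] at heven
  have hEodd : Odd E.card := by
    rcases Nat.even_or_odd E.card with he | he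
    · exact absurd heven (Nat.not_even_iff_odd.2 (hodd.add_even he))
    · exact he
  convert hEodd using 2

/-! ## §3 The column below the hole shut: the excursion takes the door `holeS | rootS` -/

/-- ★★★★ **WITH THE COLUMN BELOW THE HOLE SHUT, THE EXCURSION OF A WINDING WALK CROSSES THE `W` SIDE OF `rootS`.**
Hypothesis: `(w.1 − 1, y) ∉ D` for every `y ≤ w.2 − 2` (the cells below `holeS = (w.1 − 1, w.2 − 1)`). Then the west
edges of the lower east at rows `≤ w.2 − 2` cannot be crossed (a crossed mid-edge has both its faces in `D`), so the odd
number of west-edge crossings of §2 are all crossings of the door between `holeS` and `rootS = (w.1, w.2 − 1)`.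
[cite: CourantRobbins1958, Ch. V Appendix §2 (the even–odd rule)] [cite: Glazman2015WeightedSAW, Lemma 3.1 (proof, pp. 6–7)] -/
theorem exists_nth_eq_rootS_W_of_AJ_ne_zero_holeColumn (hcol : ∀ y : ℤ, y ≤ w.2 - 2 → ((w.1 - 1, y) : Face) ∉ D)
    (ω : ΩG D (w.side .W) (farW w)) (hr : RootedFace D (w.side .W) (farW w)) (h : ω.IsB2a)
    (hA : ω.AJ hr h (toC (midPt (w.side .W))) ≠ 0) :
    ∃ k, ω.2.firstHitG + 2 ≤ k ∧ k ≤ ω.2.arcs.length - 1 ∧ ω.2.nth k = (rootS w).side .W := by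
  classical
  have hodd := ω.odd_card_westEdgeLE_of_AJ_ne_zero hr h hA
  have hpos := hodd.pos
  rw [Finset.card_pos] at hpos
  obtain ⟨k, hk⟩ := hpos
  rw [Finset.mem_filter, Finset.mem_Ioc] at hk
  obtain ⟨⟨hk1, hk2⟩, hwest⟩ := hk
  refine ⟨k, by omega, hk2, ?_⟩
  have hd := ω.2.door_nth (j := k) (by omega) (by omega)
  cases hnth : ω.2.nth k with
  | slant x y => rw [hnth] at hwest; exact absurd hwest (by simp [IsWestEdgeLE])
  | vert x y =>
    rw [hnth] at hwest hd
    simp only [IsWestEdgeLE] at hwest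
    obtain ⟨hx, hy⟩ := hwest
    subst hx
    simp only [MidEdge.faces] at hd
    have hy1 : y = w.2 - 1 := by
      by_contra hne
      exact hcol y (by omega) hd.1
    rw [hy1, rootS_side_W_eq]

/-! ## §4 The wound forms: the excursion takes the door, the prefix never does -/

/-- ★★★★ **EVERY WOUND WALK'S EXCURSION TAKES THE DOOR `holeS | rootS`** (hole column shut; either orientation of the
winding witness — the reversed companion has the same prefix and traverses the same excursion mid-edges backwards).
[cite: GlazmanManolescu2019, Lemma 2.1 (statement, "in the form given in [Gl]")]
[cite: Glazman2015WeightedSAW, Lemma 3.1 (proof, pp. 6–7)] [cite: CourantRobbins1958, Ch. V Appendix §2 (the even–odd rule)] -/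
theorem exists_excursion_nth_eq_rootS_W_of_wound_holeColumn
    (hcol : ∀ y : ℤ, y ≤ w.2 - 2 → ((w.1 - 1, y) : Face) ∉ D)
    (ω : ΩG D (w.side .W) (farW w)) (hr : RootedFace D (w.side .W) (farW w)) (h : ω.IsB2a) {θ : ℝ}
    (hW : ω.WE (fun _ => θ) ≠ excursionWinding θ ω.2.firstSideG (ω.z1 hr h) ω.1) :
    ∃ k, ω.2.firstHitG + 2 ≤ k ∧ k ≤ ω.2.arcs.length - 1 ∧ ω.2.nth k = (rootS w).side .W := by
  rcases ω.AJ_ne_zero_or_rev_of_wound hr h θ hW with hA | hA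
  · exact exists_nth_eq_rootS_W_of_AJ_ne_zero_holeColumn hcol ω hr h hA
  · have h' := ω.rev_isB2a hr h
    obtain ⟨k, hk1, hk2, e⟩ := exists_nth_eq_rootS_W_of_AJ_ne_zero_holeColumn hcol (ω.rev hr) hr h' hA
    have hF : (ω.rev hr).2.firstHitG = ω.2.firstHitG := rev_firstHit ω hr h
    have hn : (ω.rev hr).2.arcs.length = ω.2.arcs.length := rev_snd_length ω hr h
    rw [hF] at hk1
    rw [hn] at hk2
    rw [rev_snd_nth ω hr h (by omega), if_neg (by omega)] at e
    exact ⟨ω.2.arcs.length + ω.2.firstHitG + 1 - k, by omega, by omega, e⟩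

/-- ★★★★ **THE PREFIX OF A WOUND WALK NEVER TAKES THE DOOR `holeS | rootS`** (hole column shut): the excursion takes
it (previous theorem) and a mid-edge is visited once. [cite: GlazmanManolescu2019, §1 (self-avoiding walks on mid-edges), Lemma 2.1]
[cite: Glazman2015WeightedSAW, Lemma 3.1 (proof, pp. 6–7)] [cite: CourantRobbins1958, Ch. V Appendix §2 (the even–odd rule)] -/
theorem prefix_nth_ne_rootS_W_of_wound_holeColumn (hcol : ∀ y : ℤ, y ≤ w.2 - 2 → ((w.1 - 1, y) : Face) ∉ D)
    (ω : ΩG D (w.side .W) (farW w)) (hr : RootedFace D (w.side .W) (farW w)) (h : ω.IsB2a) {θ : ℝ}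
    (hW : ω.WE (fun _ => θ) ≠ excursionWinding θ ω.2.firstSideG (ω.z1 hr h) ω.1)
    {j : ℕ} (hj : j ≤ ω.2.firstHitG) : ω.2.nth j ≠ (rootS w).side .W := by
  intro e
  obtain ⟨k, hk1, hk2, ek⟩ := exists_excursion_nth_eq_rootS_W_of_wound_holeColumn hcol ω hr h hW
  have hF := ω.fh_lt h
  have := ω.2.nth_inj_of_le (by omega) (by omega) (e.trans ek.symm)
  omega

/-- ★★★★ **AN UNDER-WALK WHOSE PREFIX RUNS ALONG THE ROW BELOW THE HOLE IS NEVER WOUND** (hole column shut): if some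
prefix mid-edge is the door `holeS | rootS` — as for every prefix `w → … → rootS → holeS → farSW → f` — the walk is
unwound. So every wound under-walk's prefix passes OVER the hole: the typed half of «removing the cell two rows below the
hole empties the under route». [cite: GlazmanManolescu2019, Lemma 2.1 (statement, "in the form given in [Gl]"), §1 (Fig. 2)]
[cite: Glazman2015WeightedSAW, Lemma 3.1 (proof, pp. 6–7)] [cite: CourantRobbins1958, Ch. V Appendix §2 (the even–odd rule)] -/
theorem not_wound_of_prefix_rootS_holeS_holeColumn (hcol : ∀ y : ℤ, y ≤ w.2 - 2 → ((w.1 - 1, y) : Face) ∉ D)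
    (ω : ΩG D (w.side .W) (farW w)) (hr : RootedFace D (w.side .W) (farW w)) (h : ω.IsB2a)
    (hpre : ∃ j, j ≤ ω.2.firstHitG ∧ ω.2.nth j = (rootS w).side .W) (θ : ℝ) :
    ω.WE (fun _ => θ) = excursionWinding θ ω.2.firstSideG (ω.z1 hr h) ω.1 := by
  by_contra hW
  obtain ⟨j, hj, e⟩ := hpre
  exact prefix_nth_ne_rootS_W_of_wound_holeColumn hcol ω hr h hW hj e

end ΩG

end Literature.Probability.RandomPlanarGeometry.SAW.YangBaxter
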